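import Summits.Parity.BatemanHorn.Theorems.RoughParitySectorsOddSectorShareLinearShareOfDecouplingAux
import Summits.Parity.BatemanHorn.Theorems.RoughParitySectorsOddSectorShareLinearOneFormShare
import Summits.Parity.BatemanHorn.Theorems.RoughParitySectorsOddSectorShareLinearIntegerShare
import Summits.Parity.BatemanHorn.Theorems.RoughParitySectorsOddSectorShareLinearSieveDecouplingPrime
import Summits.Parity.BatemanHorn.Theorems.RoughParitySectorsOddSectorShareLinearSieveDecouplingOddOfBV
import Summits.Parity.BatemanHorn.Theorems.RoughParitySectorsOddSectorShareLinearRoughCellsBV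
import HarnessLib

/-!
# Route `RoughParitySectors`, crux `OddSectorShareLinear` (stmt-Parity-15629), line `birth`:
# the crux AT ONE SYSTEM from background decoupling AT THAT SYSTEM (`stub_shareOfDecoupling`)

`--supports stmt-Parity-15629` file.  For every all-linear Bateman–Horn system `f`: IF member `m`'s
prime-within-odd odds do not feel the prime/odd constraints on the other members (D at `f`, all `m`:
`|c⁽ᵐ⁺¹⁾·O_m − c⁽ᵐ⁾·P_m| ≤ η·c⁽ᵐ⁾·P_m` for `U ≥ U₀(η)`, eventually in `x`), THEN
`|c₁·(U e^{−γ}/2)^k − c_odd| ≤ η·c_odd` for `U ≥ U₀(η)`, eventually in `x` (the crux's conclusion at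
`f`).  Here `R` is the jointly rough set, `c⁽ʲ⁾ = #{n ∈ R : Ω(fᵢ(n)) = 1 (i < j), Ω(fᵢ(n)) odd
(i ≥ j)}` the mixed cells (`c⁽⁰⁾ = c_odd`, `c⁽ᵏ⁾ = c₁`), and `P_m, O_m` are member `m`'s marginal
prime / odd cells in `R`.

Everything else of the line is a THEOREM of the tree (imported): S'a `stub_sieveDecouplingPrime`,
S'b `stub_sieveDecouplingOdd_of_roughCellsBV` ∘ B `stub_roughCellsBV`, S'' `stub_oneFormShare`,
Z `stub_integerShare`; the relative-error bookkeeping over abstract cells (`ratio_ev`, `sifted_ev`,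
`memberStep_ev`) is `…ShareOfDecouplingAux.lean`.  This file adds the telescoping of the `k` member
steps (`telescope`, `one_add_pow_le_of_small`, `share_of_steps`), the two concrete inputs
(`one_sub_div_card_nonneg`: the sieve factor is `≥ 0`; `intPrimeCell_pos`: Bertrand), and the
instantiation at the crux's inline cells (`stub_shareOfDecoupling`: the cell inclusions
`c⁽ᵐ⁺¹⁾ ≤ c⁽ᵐ⁾ ≤ O_m`, `P_m ≤ Q_m ≤ N_m`, `O_m ≤ N_m` and the identifications `c⁽ᵏ⁾ = c₁`,
`c⁽⁰⁾ = c_odd`).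
-/

noncomputable section

open Filter Finset Polynomial
open scoped BigOperators Topology
open Literature.NumberTheory.Sieve

namespace Summit.Parity.BatemanHorn.Cruxes.OddSectorShareLinear.Birth

namespace ShareOfDecoupling

/-! ### Telescoping the member steps -/

/-- Telescoping `k` relative-error steps. [folklore] -/
theorem telescope {k : ℕ} (c : ℕ → ℝ) (A δ : ℝ) (hδ0 : 0 ≤ δ) (hδ1 : δ ≤ 1) (hA : 0 ≤ A)
    (hc : ∀ m, 0 ≤ c m) (h : ∀ m, m < k → |c (m + 1) * A - c m| ≤ δ * c m) :
    ∀ m, m ≤ k → (1 - δ) ^ m * c 0 ≤ c m * A ^ m ∧ c m * A ^ m ≤ (1 + δ) ^ m * c 0 := by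
  intro m
  induction m with
  | zero => intro; simp
  | succ m ih =>
    intro hm
    obtain ⟨ih1, ih2⟩ := ih (Nat.le_of_succ_le hm)
    have hs := h m hm
    rw [abs_le] at hs
    obtain ⟨hs1, hs2⟩ := hs
    have hAm : 0 ≤ A ^ m := pow_nonneg hA m
    have hcm := hc m
    constructor
    · calc (1 - δ) ^ (m + 1) * c 0 = (1 - δ) * ((1 - δ) ^ m * c 0) := by ring
        _ ≤ (1 - δ) * (c m * A ^ m) := mul_le_mul_of_nonneg_left ih1 (by linarith)
        _ = ((1 - δ) * c m) * A ^ m := by ring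
        _ ≤ (c (m + 1) * A) * A ^ m := mul_le_mul_of_nonneg_right (by linarith) hAm
        _ = c (m + 1) * A ^ (m + 1) := by ring
    · calc c (m + 1) * A ^ (m + 1) = (c (m + 1) * A) * A ^ m := by ring
        _ ≤ ((1 + δ) * c m) * A ^ m := mul_le_mul_of_nonneg_right (by linarith) hAm
        _ = (1 + δ) * (c m * A ^ m) := by ring
        _ ≤ (1 + δ) * ((1 + δ) ^ m * c 0) := mul_le_mul_of_nonneg_left ih2 (by linarith)
        _ = (1 + δ) ^ (m + 1) * c 0 := by ring

/-- `(1 + δ)^m ≤ 1 + 2mδ` while `2mδ ≤ 1`. [folklore] -/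
theorem one_add_pow_le_of_small {δ : ℝ} (hδ : 0 ≤ δ) :
    ∀ m : ℕ, 2 * (m : ℝ) * δ ≤ 1 → (1 + δ) ^ m ≤ 1 + 2 * (m : ℝ) * δ
  | 0 => by intro; simp
  | (m + 1) => by
      intro h
      push_cast at h ⊢
      have h' : 2 * (m : ℝ) * δ ≤ 1 := by nlinarith
      have ih := one_add_pow_le_of_small hδ m h'
      have hmδ : (2 * (m : ℝ) * δ) * δ ≤ δ := mul_le_of_le_one_left hδ h'
      calc (1 + δ) ^ (m + 1) = (1 + δ) ^ m * (1 + δ) := pow_succ _ _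
        _ ≤ (1 + 2 * (m : ℝ) * δ) * (1 + δ) := mul_le_mul_of_nonneg_right ih (by linarith)
        _ = 1 + 2 * (m : ℝ) * δ + δ + (2 * (m : ℝ) * δ) * δ := by ring
        _ ≤ 1 + 2 * ((m : ℝ) + 1) * δ := by linarith

/-- **Telescoping the member steps** over abstract cells `c⁽ʲ⁾`: the `k` steps
`|c⁽ᵐ⁺¹⁾·A(U) − c⁽ᵐ⁾| ≤ δ·c⁽ᵐ⁾` at `δ = min(1, η)/(2k+2)` give `|c⁽ᵏ⁾·A(U)^k − c⁽⁰⁾| ≤ η·c⁽⁰⁾`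
(stated for any cells `ck = c⁽ᵏ⁾`, `c0 = c⁽⁰⁾`). [folklore] -/
theorem share_of_steps {k : ℕ} (c : ℕ → ℝ → ℕ → ℕ) {ck c0 : ℝ → ℕ → ℕ} {A : ℝ → ℝ}
    (hA : ∀ U : ℝ, 0 < U → 0 ≤ A U)
    (hck : ∀ U x, c k U x = ck U x) (hc0 : ∀ U x, c 0 U x = c0 U x)
    (hstep : ∀ m : Fin k, ∀ η : ℝ, 0 < η → ∃ U₀ : ℝ, ∀ U : ℝ, U₀ ≤ U → ∀ᶠ x : ℕ in atTop,
      |(c ((m : ℕ) + 1) U x : ℝ) * A U - (c m U x : ℝ)| ≤ η * (c m U x : ℝ)) :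
    ∀ η : ℝ, 0 < η → ∃ U₀ : ℝ, ∀ U : ℝ, U₀ ≤ U → ∀ᶠ x : ℕ in atTop,
      |(ck U x : ℝ) * A U ^ k - (c0 U x : ℝ)| ≤ η * (c0 U x : ℝ) := by
  intro η hη
  -- per-member tolerance δ
  have hk0 : (0 : ℝ) < 2 * (k : ℝ) + 2 := by positivity
  obtain ⟨δ, hδ⟩ : ∃ δ : ℝ, δ = min (1 / (2 * (k : ℝ) + 2)) (η / (2 * (k : ℝ) + 2)) := ⟨_, rfl⟩
  have hδ0 : 0 < δ := by rw [hδ]; exact lt_min (by positivity) (by positivity)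
  have hδa : δ ≤ 1 / (2 * (k : ℝ) + 2) := hδ ▸ min_le_left _ _
  have hδb : δ ≤ η / (2 * (k : ℝ) + 2) := hδ ▸ min_le_right _ _
  have hkn : (0 : ℝ) ≤ 2 * (k : ℝ) := by positivity
  have hδ1 : δ ≤ 1 := hδa.trans (by rw [div_le_one hk0]; linarith)
  have h2kδ : 2 * (k : ℝ) * δ ≤ 1 :=
    calc 2 * (k : ℝ) * δ ≤ 2 * (k : ℝ) * (1 / (2 * (k : ℝ) + 2)) :=
          mul_le_mul_of_nonneg_left hδa hkn
      _ = 2 * (k : ℝ) / (2 * (k : ℝ) + 2) := by ring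
      _ ≤ 1 := by rw [div_le_one hk0]; linarith
  have h2kδη : 2 * (k : ℝ) * δ ≤ η :=
    calc 2 * (k : ℝ) * δ ≤ 2 * (k : ℝ) * (η / (2 * (k : ℝ) + 2)) :=
          mul_le_mul_of_nonneg_left hδb hkn
      _ = η * (2 * (k : ℝ) / (2 * (k : ℝ) + 2)) := by ring
      _ ≤ η * 1 := mul_le_mul_of_nonneg_left (by rw [div_le_one hk0]; linarith) hη.le
      _ = η := mul_one η
  -- one threshold per member, then a common one
  choose U₀ hU₀ using fun m : Fin k => hstep m δ hδ0
  refine ⟨1 + ∑ m, |U₀ m|, fun U hU => ?_⟩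
  have hsum : 0 ≤ ∑ m, |U₀ m| := Finset.sum_nonneg fun m _ => abs_nonneg _
  have hU0 : 0 < U := by linarith
  have hUm : ∀ m, U₀ m ≤ U := fun m =>
    (le_abs_self _).trans
      ((Finset.single_le_sum (fun i _ => abs_nonneg (U₀ i)) (Finset.mem_univ m)).trans
        (by linarith))
  have hall : ∀ᶠ x : ℕ in atTop, ∀ m : Fin k,
      |(c ((m : ℕ) + 1) U x : ℝ) * A U - (c m U x : ℝ)| ≤ δ * (c m U x : ℝ) :=
    Filter.eventually_all.2 fun m => hU₀ m U (hUm m)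
  filter_upwards [hall] with x hx
  obtain ⟨t1, t2⟩ := telescope (k := k) (fun m => (c m U x : ℝ)) (A U) δ hδ0.le hδ1 (hA U hU0)
    (fun m => Nat.cast_nonneg _) (fun m hm => hx ⟨m, hm⟩) k le_rfl
  simp only [hck, hc0] at t1 t2
  have hc00 : (0 : ℝ) ≤ (c0 U x : ℝ) := Nat.cast_nonneg _
  have hup : (1 + δ) ^ k ≤ 1 + 2 * (k : ℝ) * δ := one_add_pow_le_of_small hδ0.le k h2kδ
  have hlo : 1 - (k : ℝ) * δ ≤ (1 - δ) ^ k := by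
    have h := one_add_mul_le_pow (show (-2 : ℝ) ≤ -δ by linarith) k
    have e : (1 : ℝ) + -δ = 1 - δ := by ring
    rw [e] at h
    linarith
  have f1 := mul_le_mul_of_nonneg_right hup hc00
  have f2 := mul_le_mul_of_nonneg_right hlo hc00
  have f3 := mul_le_mul_of_nonneg_right h2kδη hc00
  have hkδ : 0 ≤ (k : ℝ) * δ * (c0 U x : ℝ) := by positivity
  rw [abs_le]
  constructor <;> nlinarith

/-! ### The two concrete inputs -/

/-- `0 ≤ 1 − #s/#t` for `s ⊆ t` (the sieve factor's local factors are nonnegative). [folklore] -/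
theorem one_sub_div_card_nonneg {s t : Finset ℕ} (h : s ⊆ t) :
    (0 : ℝ) ≤ 1 - ((s.card : ℕ) : ℝ) / ((t.card : ℕ) : ℝ) := by
  have hst : s.card ≤ t.card := Finset.card_le_card h
  rcases Nat.eq_zero_or_pos t.card with h0 | h0
  · rw [h0]; simp
  · rw [sub_nonneg, div_le_one (by exact_mod_cast h0)]
    exact_mod_cast hst

/-- The integers' prime cell is non-empty for `U ≥ 2` and `x ≥ 4` (Bertrand: a prime in
`(x/2, x]` exceeds `x^{1/2} ≥ x^{1/U}`). [folklore] -/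
theorem intPrimeCell_pos : ∀ U : ℝ, 2 ≤ U → ∀ᶠ x : ℕ in atTop,
    0 < (((Finset.Icc 1 x).filter (fun n : ℕ => ∀ p ∈ Finset.range ⌈(x : ℝ) ^ (1 / U)⌉₊,
      p.Prime → ¬ (p ∣ n))).filter (fun n : ℕ => ArithmeticFunction.cardFactors n = 1)).card := by
  intro U hU
  filter_upwards [eventually_ge_atTop 4] with x hx
  obtain ⟨p, hp, hlt, hle⟩ := Nat.exists_prime_lt_and_le_two_mul (x / 2) (by omega)
  have hpx : p ≤ x := hle.trans (Nat.mul_div_le x 2)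
  refine Finset.card_pos.2 ⟨p, ?_⟩
  rw [Finset.mem_filter, Finset.mem_filter, Finset.mem_Icc]
  refine ⟨⟨⟨hp.one_lt.le, hpx⟩, fun q hq hqp hqd => ?_⟩,
    ArithmeticFunction.cardFactors_apply_prime hp⟩
  have hqp' : q = p := (Nat.prime_dvd_prime_iff_eq hqp hp).1 hqd
  subst hqp'
  have h1 : (q : ℝ) < (x : ℝ) ^ (1 / U) := Nat.lt_ceil.1 (Finset.mem_range.1 hq)
  have hx4 : (4 : ℝ) ≤ x := by exact_mod_cast hx
  have hx1 : (1 : ℝ) ≤ x := by linarith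
  have hx0 : (0 : ℝ) < x := by linarith
  have h2 : (x : ℝ) ^ (1 / U) ≤ (x : ℝ) ^ (1 / 2 : ℝ) :=
    Real.rpow_le_rpow_of_exponent_le hx1 (one_div_le_one_div_of_le (by norm_num) hU)
  have h3 : (x : ℝ) ^ (1 / 2 : ℝ) * (x : ℝ) ^ (1 / 2 : ℝ) = x := by
    rw [← Real.rpow_add hx0]; norm_num
  have hs0 : 0 ≤ (x : ℝ) ^ (1 / 2 : ℝ) := Real.rpow_nonneg hx0.le _
  have h4 : (2 : ℝ) ≤ (x : ℝ) ^ (1 / 2 : ℝ) := by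
    rcases le_or_gt (2 : ℝ) ((x : ℝ) ^ (1 / 2 : ℝ)) with h | h
    · exact h
    · have := mul_self_lt_mul_self hs0 h
      linarith
  have h5 : (x : ℝ) ^ (1 / 2 : ℝ) ≤ x / 2 := by nlinarith
  have h6 : x < 2 * q := by omega
  have h7 : (x : ℝ) < 2 * q := by exact_mod_cast h6
  linarith

end ShareOfDecoupling

/-- **The crux at one system from D at that system** — registered sub-goal `stub_shareOfDecoupling`
of crux stmt-Parity-15629 (line `birth`), verbatim: `k` member steps
(`ShareOfDecoupling.memberStep_ev` from D at `f`, the tree theorems S'a, S'b ∘ B, S'', Z, and the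
cell inclusions), telescoped (`ShareOfDecoupling.share_of_steps`). [folklore] -/
theorem stub_shareOfDecoupling :
    ∀ (k : ℕ) (f : Fin k → Polynomial ℤ), Literature.NumberTheory.Sieve.IsBatemanHornSystem f → (∀
    i, (f i).natDegree ≤ 1) → (∀ (m : Fin k) (η : ℝ), 0 < η → ∃ U₀ : ℝ, ∀ U : ℝ, U₀ ≤ U → ∀ᶠ x : ℕ
    in Filter.atTop, |(((((Finset.Icc 1 x).filter (fun n : ℕ => ∀ i, 0 < (f i).eval (n : ℤ) ∧ ∀ p ∈
    Finset.range ⌈(x : ℝ) ^ (((f i).natDegree : ℝ) / U)⌉₊, p.Prime → ¬ ((p : ℤ) ∣ (f i).eval (n :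
    ℤ)))).filter (fun n : ℕ => ∀ i : Fin k, ((i : ℕ) < (m : ℕ) + 1 → ArithmeticFunction.cardFactors
    (((f i).eval (n : ℤ)).toNat) = 1) ∧ ((m : ℕ) + 1 ≤ (i : ℕ) → Odd (ArithmeticFunction.cardFactors
    (((f i).eval (n : ℤ)).toNat))))).card : ℕ) : ℝ) * (((((Finset.Icc 1 x).filter (fun n : ℕ => ∀ i,
    0 < (f i).eval (n : ℤ) ∧ ∀ p ∈ Finset.range ⌈(x : ℝ) ^ (((f i).natDegree : ℝ) / U)⌉₊, p.Prime →
    ¬ ((p : ℤ) ∣ (f i).eval (n : ℤ)))).filter (fun n : ℕ => Odd (ArithmeticFunction.cardFactors (((f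
    m).eval (n : ℤ)).toNat)))).card : ℕ) : ℝ) - (((((Finset.Icc 1 x).filter (fun n : ℕ => ∀ i, 0 <
    (f i).eval (n : ℤ) ∧ ∀ p ∈ Finset.range ⌈(x : ℝ) ^ (((f i).natDegree : ℝ) / U)⌉₊, p.Prime → ¬
    ((p : ℤ) ∣ (f i).eval (n : ℤ)))).filter (fun n : ℕ => ∀ i : Fin k, ((i : ℕ) < (m : ℕ) →
    ArithmeticFunction.cardFactors (((f i).eval (n : ℤ)).toNat) = 1) ∧ ((m : ℕ) ≤ (i : ℕ) → Odd
    (ArithmeticFunction.cardFactors (((f i).eval (n : ℤ)).toNat))))).card : ℕ) : ℝ) *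
    (((((Finset.Icc 1 x).filter (fun n : ℕ => ∀ i, 0 < (f i).eval (n : ℤ) ∧ ∀ p ∈ Finset.range ⌈(x :
    ℝ) ^ (((f i).natDegree : ℝ) / U)⌉₊, p.Prime → ¬ ((p : ℤ) ∣ (f i).eval (n : ℤ)))).filter (fun n :
    ℕ => ArithmeticFunction.cardFactors (((f m).eval (n : ℤ)).toNat) = 1)).card : ℕ) : ℝ)| ≤ η *
    ((((((Finset.Icc 1 x).filter (fun n : ℕ => ∀ i, 0 < (f i).eval (n : ℤ) ∧ ∀ p ∈ Finset.range ⌈(x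
    : ℝ) ^ (((f i).natDegree : ℝ) / U)⌉₊, p.Prime → ¬ ((p : ℤ) ∣ (f i).eval (n : ℤ)))).filter (fun n
    : ℕ => ∀ i : Fin k, ((i : ℕ) < (m : ℕ) → ArithmeticFunction.cardFactors (((f i).eval (n :
    ℤ)).toNat) = 1) ∧ ((m : ℕ) ≤ (i : ℕ) → Odd (ArithmeticFunction.cardFactors (((f i).eval (n :
    ℤ)).toNat))))).card : ℕ) : ℝ) * (((((Finset.Icc 1 x).filter (fun n : ℕ => ∀ i, 0 < (f i).eval (n
    : ℤ) ∧ ∀ p ∈ Finset.range ⌈(x : ℝ) ^ (((f i).natDegree : ℝ) / U)⌉₊, p.Prime → ¬ ((p : ℤ) ∣ (f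
    i).eval (n : ℤ)))).filter (fun n : ℕ => ArithmeticFunction.cardFactors (((f m).eval (n :
    ℤ)).toNat) = 1)).card : ℕ) : ℝ))) → ∀ η : ℝ, 0 < η → ∃ U₀ : ℝ, ∀ U : ℝ, U₀ ≤ U → ∀ᶠ x : ℕ in
    Filter.atTop, |(((((Finset.Icc 1 x).filter (fun n : ℕ => ∀ i, 0 < (f i).eval (n : ℤ) ∧ ∀ p ∈
    Finset.range ⌈(x : ℝ) ^ (((f i).natDegree : ℝ) / U)⌉₊, p.Prime → ¬ ((p : ℤ) ∣ (f i).eval (n :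
    ℤ)))).filter (fun n : ℕ => ∀ i, ArithmeticFunction.cardFactors (((f i).eval (n : ℤ)).toNat) =
    1)).card : ℕ) : ℝ) * (U * Real.exp (-Real.eulerMascheroniConstant) / 2) ^ k - (((((Finset.Icc 1
    x).filter (fun n : ℕ => ∀ i, 0 < (f i).eval (n : ℤ) ∧ ∀ p ∈ Finset.range ⌈(x : ℝ) ^ (((f
    i).natDegree : ℝ) / U)⌉₊, p.Prime → ¬ ((p : ℤ) ∣ (f i).eval (n : ℤ)))).filter (fun n : ℕ => ∀ i,
    Odd (ArithmeticFunction.cardFactors (((f i).eval (n : ℤ)).toNat)))).card : ℕ) : ℝ)| ≤ η *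
    (((((Finset.Icc 1 x).filter (fun n : ℕ => ∀ i, 0 < (f i).eval (n : ℤ) ∧ ∀ p ∈ Finset.range ⌈(x :
    ℝ) ^ (((f i).natDegree : ℝ) / U)⌉₊, p.Prime → ¬ ((p : ℤ) ∣ (f i).eval (n : ℤ)))).filter (fun n :
    ℕ => ∀ i, Odd (ArithmeticFunction.cardFactors (((f i).eval (n : ℤ)).toNat)))).card : ℕ) : ℝ) := by
  intro k f hf hdeg hD
  refine ShareOfDecoupling.share_of_steps
    (fun (j : ℕ) (U : ℝ) (x : ℕ) => (((Finset.Icc 1 x).filter (fun n : ℕ => ∀ i, 0 < (f i).eval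
      (n : ℤ) ∧ ∀ p ∈ Finset.range ⌈(x : ℝ) ^ (((f i).natDegree : ℝ) / U)⌉₊, p.Prime →
      ¬ ((p : ℤ) ∣ (f i).eval (n : ℤ)))).filter (fun n : ℕ => ∀ i : Fin k, ((i : ℕ) < j →
      ArithmeticFunction.cardFactors (((f i).eval (n : ℤ)).toNat) = 1) ∧ (j ≤ (i : ℕ) →
      Odd (ArithmeticFunction.cardFactors (((f i).eval (n : ℤ)).toNat))))).card)
    (fun U hU => by positivity) (fun U x => ?_) (fun U x => ?_)
    (fun m => ShareOfDecoupling.memberStep_ev (fun U x => ?_) (fun U x => ?_)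
      ShareOfDecoupling.intPrimeCell_pos (fun U hU => by positivity) (hD m)
      (ShareOfDecoupling.sifted_ev (fun U x => ?_) (fun U x => ?_) (fun U x => ?_)
        (ShareOfDecoupling.ratio_ev (fun U x => ?_) (stub_sieveDecouplingPrime k f hf hdeg m)
          (stub_sieveDecouplingOdd_of_roughCellsBV stub_roughCellsBV k f hf hdeg m))
        (stub_oneFormShare k f hf hdeg m))
      stub_integerShare)
  -- `c⁽ᵏ⁾ = c₁`
  · refine congrArg Finset.card (Finset.filter_congr fun n _ => ?_)
    exact ⟨fun h i => (h i).1 i.is_lt,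
      fun h i => ⟨fun _ => h i, fun hk => absurd i.is_lt (not_lt.2 hk)⟩⟩
  -- `c⁽⁰⁾ = c_odd`
  · refine congrArg Finset.card (Finset.filter_congr fun n _ => ?_)
    exact ⟨fun h i => (h i).2 (Nat.zero_le _), fun h i => ⟨fun hi => absurd hi (Nat.not_lt_zero _),
      fun _ => h i⟩⟩
  -- `c⁽ᵐ⁺¹⁾ ≤ c⁽ᵐ⁾` (a prime value has odd `Ω`)
  · refine Finset.card_le_card fun n hn => ?_
    rw [Finset.mem_filter] at hn ⊢
    refine ⟨hn.1, fun i => ⟨fun hi => (hn.2 i).1 (by omega), fun hi => ?_⟩⟩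
    rcases Nat.eq_or_lt_of_le hi with h | h
    · rw [(hn.2 i).1 (by omega)]
      exact odd_one
    · exact (hn.2 i).2 (by omega)
  -- `c⁽ᵐ⁾ ≤ O_m`
  · refine Finset.card_le_card fun n hn => ?_
    rw [Finset.mem_filter] at hn ⊢
    exact ⟨hn.1, (hn.2 m).2 le_rfl⟩
  -- `P_m ≤ Q_m`
  · refine Finset.card_le_card fun n hn => ?_
    simp only [Finset.mem_filter] at hn ⊢
    exact ⟨hn.1.1, hn.1.2 m, hn.2⟩
  -- `O_m ≤ N_m`
  · refine Finset.card_le_card fun n hn => ?_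
    simp only [Finset.mem_filter] at hn ⊢
    exact ⟨hn.1.1, hn.1.2 m, hn.2⟩
  -- `Q_m ≤ N_m`
  · refine Finset.card_le_card fun n hn => ?_
    simp only [Finset.mem_filter] at hn ⊢
    refine ⟨hn.1, hn.2.1, ?_⟩
    rw [hn.2.2]
    exact odd_one
  -- `0 ≤ W_m`
  · exact Finset.prod_nonneg fun p _ => ShareOfDecoupling.one_sub_div_card_nonneg fun c hc =>
      Finset.mem_filter.2 ⟨(Finset.mem_filter.1 hc).1, (Finset.mem_filter.1 hc).2.1⟩

end Summit.Parity.BatemanHorn.Cruxes.OddSectorShareLinear.Birth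

end
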